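import Mathlib
import Summits.KontsevichZagierPeriods.KontsevichZagierPeriods.Theorems.SoloInformedParamTermI
import Summits.KontsevichZagierPeriods.KontsevichZagierPeriods.Theorems.SoloInformedParamCombo
import HarnessLib

/-!
# Solo-informed (A390-ii): parametrised combinations and the definability invariant of ARBITRARY
`KZ_ℝ` chains

File F6c — step 2 of the real-parameter kernel for arbitrary chains.  The combinations are those of
`SoloInformedParamCombo`; the denotation now uses the I-admissible denotation `repI` of each term
(`comboI`), admissibility is I-admissibility of every term (`SoloInformedAdmI`), rational lifts land
in the FULL relation module `KZOver.relations ℚ` (`SoloInformedRatLiftI`), and the definability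
invariant `SoloInformedDefinableRelI c` refers to the full `KZOver.relations ℝ`.  The invariant is
closed under the group law, hence holds on all of `KZOver.relations ℝ` as soon as it holds on the
four generators (`soloInformed_definableRelI_of_mem_relations`).
-/

noncomputable section

open MeasureTheory Set
open Literature.ModelTheory.ExponentialFields Literature.NumberTheory.Transcendental

namespace Summit.KontsevichZagierPeriods.KontsevichZagierPeriods.Theorems

namespace SoloInformedPCombo

variable {K K' : Type} (P Q : SoloInformedPCombo K) (p : K → ℝ) (θ : K → K') (p' : K' → ℝ)

/-- The element of `KZOver.FormalRep ℝ` denoted at parameter `p` (I-admissible denotations).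
[cite: KontsevichZagier2001, §1.2] -/
def comboI : KZOver.FormalRep ℝ := ∑ t, P.coef t • KZOver.of ((P.term t).repI p)

/-- All terms are I-admissible at `p`. [cite: KontsevichZagier2001, §1.1] -/
def SoloInformedAdmI (P : SoloInformedPCombo K) (p : K → ℝ) : Prop :=
  ∀ t, (P.term t).SoloInformedAdmI p

/-- **Rational lift** at `p`: every denoted representation is the base change of a
`ℚ`-representation and the lifted combination is a relation over `ℚ`.
[cite: KontsevichZagier2001, §1.2] -/
def SoloInformedRatLiftI (P : SoloInformedPCombo K) (p : K → ℝ) : Prop :=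
  ∃ q : (t : P.ι) → KZOver.IntegralRep ℚ (P.dim t),
    (∀ t, (q t).baseChange ℝ = (P.term t).repI p) ∧
    ∑ t, P.coef t • KZOver.of (q t) ∈ KZOver.relations ℚ

/-- The denoted element is invariant under pull-back. [cite: KontsevichZagier2001, §1.2] -/
theorem comboI_pullback : (P.pullback θ).comboI p' = P.comboI (p' ∘ θ) := by
  show ∑ t : P.ι, P.coef t • KZOver.of (((P.term t).pullback θ).repI p') = _
  simp only [SoloInformedPTerm.repI_pullback, comboI]

/-- I-admissibility is invariant under pull-back. [cite: KontsevichZagier2001, §1.1] -/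
theorem admI_pullback_iff : (P.pullback θ).SoloInformedAdmI p' ↔ P.SoloInformedAdmI (p' ∘ θ) :=
  forall_congr' fun t => SoloInformedPTerm.admI_pullback_iff (P.term t) θ p'

/-- Rational lifts pull back. [cite: KontsevichZagier2001, §1.2] -/
theorem ratLiftI_pullback (h : P.SoloInformedRatLiftI (p' ∘ θ)) :
    (P.pullback θ).SoloInformedRatLiftI p' := by
  obtain ⟨q, hq, hrel⟩ := h
  exact ⟨q, fun t => (hq t).trans (SoloInformedPTerm.repI_pullback (P.term t) θ p').symm, hrel⟩

/-- The sum denotes the sum. [cite: KontsevichZagier2001, §1.2] -/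
theorem comboI_add : (P.add Q).comboI p = P.comboI p + Q.comboI p := by
  show ∑ t : P.ι ⊕ Q.ι, (P.add Q).coef t • KZOver.of (((P.add Q).term t).repI p) = _
  rw [Fintype.sum_sum_type]
  rfl

/-- I-admissibility of a sum. [cite: KontsevichZagier2001, §1.1] -/
theorem admI_add (hP : P.SoloInformedAdmI p) (hQ : Q.SoloInformedAdmI p) :
    (P.add Q).SoloInformedAdmI p := by
  rintro (a | b)
  · exact hP a
  · exact hQ b

/-- Rational lifts add. [cite: KontsevichZagier2001, §1.2] -/
theorem ratLiftI_add (hP : P.SoloInformedRatLiftI p) (hQ : Q.SoloInformedRatLiftI p) :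
    (P.add Q).SoloInformedRatLiftI p := by
  obtain ⟨q₁, hq₁, h₁⟩ := hP
  obtain ⟨q₂, hq₂, h₂⟩ := hQ
  refine ⟨fun t => match t with
    | Sum.inl a => q₁ a
    | Sum.inr b => q₂ b, ?_, ?_⟩
  · rintro (a | b)
    · exact hq₁ a
    · exact hq₂ b
  · show (∑ t : P.ι ⊕ Q.ι, _) ∈ _
    rw [Fintype.sum_sum_type]
    exact add_mem h₁ h₂

/-- The negative denotes the negative. [cite: KontsevichZagier2001, §1.2] -/
theorem comboI_neg : P.neg.comboI p = -P.comboI p := by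
  show ∑ t : P.ι, -P.coef t • KZOver.of ((P.term t).repI p) = _
  simp only [neg_zsmul, Finset.sum_neg_distrib, comboI]

/-- I-admissibility of the negative. [cite: KontsevichZagier2001, §1.1] -/
theorem admI_neg_iff : P.neg.SoloInformedAdmI p ↔ P.SoloInformedAdmI p := Iff.rfl

/-- Rational lifts of the negative. [cite: KontsevichZagier2001, §1.2] -/
theorem ratLiftI_neg (h : P.SoloInformedRatLiftI p) : P.neg.SoloInformedRatLiftI p := by
  obtain ⟨q, hq, hrel⟩ := h
  refine ⟨q, hq, ?_⟩
  show ∑ t : P.ι, -P.coef t • KZOver.of (q t) ∈ _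
  simp only [neg_zsmul, Finset.sum_neg_distrib]
  exact neg_mem hrel

/-- The empty combination denotes `0`. [cite: KontsevichZagier2001, §1.2] -/
theorem comboI_zero (p : K → ℝ) : (zero K).comboI p = 0 := by
  simp [comboI, zero]

/-- The empty combination is I-admissible. [cite: KontsevichZagier2001, §1.1] -/
theorem admI_zero (p : K → ℝ) : (zero K).SoloInformedAdmI p := fun t => Fin.elim0 t

/-- The empty combination lifts. [cite: KontsevichZagier2001, §1.2] -/
theorem ratLiftI_zero (p : K → ℝ) : (zero K).SoloInformedRatLiftI p :=
  ⟨fun t => Fin.elim0 t, fun t => Fin.elim0 t, by simp [zero, (KZOver.relations ℚ).zero_mem]⟩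

/-- The I-admissible locus of a combination is `ℚ`-semialgebraic (conditional on the Lion–Rolin
preparation fact). [cite: ComteLionRolin2000, Thm. 3] -/
theorem isSemialgebraic_setOf_admI (hprep : semialgebraicPreparation) [Finite K]
    (P : SoloInformedPCombo K) : IsSemialgebraic ℚ {p : K → ℝ | P.SoloInformedAdmI p} :=
  soloInformed_isSemialgebraic_setOf_forall_fin fun t =>
    SoloInformedPTerm.isSemialgebraic_setOf_admI hprep (P.term t)

end SoloInformedPCombo

/-! ### The definability invariant for arbitrary chains -/

/-- The four generators of `KZOver.relations k`. [cite: KontsevichZagier2001, §1.2] -/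
def soloInformedGenerators (k : Type*) [Field k] [Algebra k ℝ] : Set (KZOver.FormalRep k) :=
  KZOver.domainAddRel k ∪ KZOver.integrandAddRel k ∪ KZOver.changeOfVariablesRel k ∪
    KZOver.newtonLeibnizRel k

/-- `KZOver.relations k` is the closure of the four generators. [cite: KontsevichZagier2001, §1.2] -/
theorem soloInformed_relations_eq_closure (k : Type*) [Field k] [Algebra k ℝ] :
    KZOver.relations k = AddSubgroup.closure (soloInformedGenerators k) := rfl

/-- **The definability invariant** of an element of `KZOver.FormalRep ℝ`, for arbitrary chains:
`c = P.comboI p₀` for a combination whose good parameters form a `ℚ`-semialgebraic set `V ∋ p₀`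
(good = I-admissible, denotes a real relation, and lifts to a rational relation at parameters with
rational fibres). [cite: KontsevichZagier2001, §1.2] -/
def SoloInformedDefinableRelI (c : KZOver.FormalRep ℝ) : Prop :=
  ∃ (K : Type) (_ : Fintype K) (P : SoloInformedPCombo K) (p₀ : K → ℝ) (V : Set (K → ℝ)),
    IsSemialgebraic ℚ V ∧ p₀ ∈ V ∧ P.comboI p₀ = c ∧
    (∀ p ∈ V, P.SoloInformedAdmI p ∧ P.comboI p ∈ KZOver.relations ℝ) ∧
    (∀ p ∈ V, SoloInformedRatFibres p → P.SoloInformedRatLiftI p)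

/-- `0` is definable. [cite: KontsevichZagier2001, §1.2] -/
theorem soloInformed_definableRelI_zero : SoloInformedDefinableRelI 0 :=
  ⟨Fin 0, inferInstance, SoloInformedPCombo.zero (Fin 0), Fin.elim0, univ, isSemialgebraic_univ,
    mem_univ _, SoloInformedPCombo.comboI_zero _,
    fun p _ => ⟨SoloInformedPCombo.admI_zero p, by
      rw [SoloInformedPCombo.comboI_zero]; exact (KZOver.relations ℝ).zero_mem⟩,
    fun p _ _ => SoloInformedPCombo.ratLiftI_zero p⟩

/-- Definable elements are closed under negation. [cite: KontsevichZagier2001, §1.2] -/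
theorem soloInformed_definableRelI_neg {c : KZOver.FormalRep ℝ} (h : SoloInformedDefinableRelI c) :
    SoloInformedDefinableRelI (-c) := by
  obtain ⟨K, hK, P, p₀, V, hV, hp₀, hc, hgood, hrat⟩ := h
  refine ⟨K, hK, P.neg, p₀, V, hV, hp₀, by rw [SoloInformedPCombo.comboI_neg, hc], fun p hp =>
    ⟨(P.admI_neg_iff p).2 (hgood p hp).1, ?_⟩, fun p hp hr => P.ratLiftI_neg p (hrat p hp hr)⟩
  rw [SoloInformedPCombo.comboI_neg]
  exact neg_mem (hgood p hp).2

/-- **Definable elements are closed under addition** (parameter spaces multiply: `K₁ ⊕ K₂`).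
[cite: KontsevichZagier2001, §1.2] -/
theorem soloInformed_definableRelI_add {c₁ c₂ : KZOver.FormalRep ℝ}
    (h₁ : SoloInformedDefinableRelI c₁) (h₂ : SoloInformedDefinableRelI c₂) :
    SoloInformedDefinableRelI (c₁ + c₂) := by
  obtain ⟨K₁, hK₁, P₁, p₁, V₁, hV₁, hp₁, hc₁, hgood₁, hrat₁⟩ := h₁
  obtain ⟨K₂, hK₂, P₂, p₂, V₂, hV₂, hp₂, hc₂, hgood₂, hrat₂⟩ := h₂
  refine ⟨K₁ ⊕ K₂, inferInstance, (P₁.pullback Sum.inl).add (P₂.pullback Sum.inr), Sum.elim p₁ p₂,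
    {p | p ∘ Sum.inl ∈ V₁} ∩ {p | p ∘ Sum.inr ∈ V₂},
    (hV₁.preimage_comp Sum.inl).inter (hV₂.preimage_comp Sum.inr),
    ⟨by simpa using hp₁, by simpa using hp₂⟩, ?_, fun p hp => ⟨?_, ?_⟩, fun p hp hr => ?_⟩
  · rw [SoloInformedPCombo.comboI_add, SoloInformedPCombo.comboI_pullback,
      SoloInformedPCombo.comboI_pullback, Sum.elim_comp_inl, Sum.elim_comp_inr, hc₁, hc₂]
  · exact SoloInformedPCombo.admI_add _ _ p
      ((P₁.admI_pullback_iff Sum.inl p).2 (hgood₁ _ hp.1).1)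
      ((P₂.admI_pullback_iff Sum.inr p).2 (hgood₂ _ hp.2).1)
  · rw [SoloInformedPCombo.comboI_add, SoloInformedPCombo.comboI_pullback,
      SoloInformedPCombo.comboI_pullback]
    exact add_mem (hgood₁ _ hp.1).2 (hgood₂ _ hp.2).2
  · exact SoloInformedPCombo.ratLiftI_add _ _ p
      (P₁.ratLiftI_pullback Sum.inl p (hrat₁ _ hp.1 (soloInformedRatFibres_comp hr Sum.inl)))
      (P₂.ratLiftI_pullback Sum.inr p (hrat₂ _ hp.2 (soloInformedRatFibres_comp hr Sum.inr)))

/-- **Closure induction.** If the four generators of `KZ_ℝ` are definable, every real relation is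
definable. [cite: KontsevichZagier2001, §1.2] -/
theorem soloInformed_definableRelI_of_mem_relations
    (hgen : ∀ c ∈ soloInformedGenerators ℝ, SoloInformedDefinableRelI c)
    {c : KZOver.FormalRep ℝ} (hc : c ∈ KZOver.relations ℝ) :
    SoloInformedDefinableRelI c := by
  rw [soloInformed_relations_eq_closure] at hc
  induction hc using AddSubgroup.closure_induction with
  | mem x hx => exact hgen x hx
  | zero => exact soloInformed_definableRelI_zero
  | add x y _ _ hx hy => exact soloInformed_definableRelI_add hx hy
  | neg x _ hx => exact soloInformed_definableRelI_neg hx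

end Summit.KontsevichZagierPeriods.KontsevichZagierPeriods.Theorems
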